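import Mathlib
import HarnessLib
import Literature.Analysis.FluidPDE.VectorCalculus
import Summits.NavierStokesRegularity.NavierStokesRegularity.Theorems.UnthreadedRigidityDoorUnthreadedRigidityProfileHornDefs

/-!
# Route `UnthreadedRigidityDoor`, item `UnthreadedRigidity` (W2, stmt-NavierStokesRegularity-27585) — LINE g10-2 «PROFILE HORN»:
# S-0 `NullProfileShellZero` BY NAME (warm-up): the null profile gives the zero shell

Prover file (W2 Lean hand ns-crc-p1 g7, keyed by DIRECTOR-NS dss_128 / KEY-NS #184; `--supports stmt-NavierStokesRegularity-27585 --as helper`)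
for LINE g10-2 «PROFILE HORN» of planner ns-idea-6 g10 on the wall item `UnthreadedRigidity` (route `UnthreadedRigidityDoor`, W2;
idea-crit-4 g6 PASS 2026-08-29T01:30:55Z; sketch `pub/ideators/ns-idea-6/lines/UnthreadedRigidityDoor/ProfileHorn_sketch.lean` sha16
916bdf9b3eac7d48; objects and statements BY NAME in `Theorems/UnthreadedRigidityDoorUnthreadedRigidityProfileHornDefs.lean`).

S-0 of the sketch, proved exactly as there (`curl` of the zero field is the zero field, twice): `nullProfileShellZero_holds :
NullProfileShellZero` with `NullProfileShellZero`, `sepShell`, `quadY` the tree objects of the Defs twin.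

HONEST LABEL: one-dimensional real analysis about the radial profile of SPECIAL (separable `l = 2`) slice data; it is a piece of a LINE on
the wall item, not the item: `UnthreadedRigidity` (27585), W2 and NS regularity remain OPEN; nothing here is a statement about the
Navier–Stokes equations.  0 kit.
-/

-- the summit and its single sub-problem share the name (CONVENTIONS §1), as in every Theorems file
set_option linter.dupNamespace false

namespace Summit.NavierStokesRegularity.NavierStokesRegularity.Theorems.UnthreadedRigidity.ProfileHorn

open scoped Topology
open Filter Set MeasureTheory

/-- `curl` of the zero field is the zero field (from the definition: every `fderiv` vanishes). -/
lemma curl_zero_field :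
    Literature.Analysis.FluidPDE.curl (fun _ : E3 => (0 : E3)) = fun _ => (0 : E3) := by
  funext x
  ext i
  fin_cases i <;> simp [Literature.Analysis.FluidPDE.curl]

/-- S-0 holds (proved): the null profile gives the zero field. -/
theorem nullProfileShellZero_holds : NullProfileShellZero := by
  intro H Q x₀ hH x
  have h0 : (fun x : E3 => (H ‖x - x₀‖ * quadY Q (x - x₀)) • (x - x₀)) = fun _ => (0 : E3) := by
    funext x'
    rw [hH ‖x' - x₀‖ (norm_nonneg _), zero_mul, zero_smul]
  show Literature.Analysis.FluidPDE.curl (Literature.Analysis.FluidPDE.curl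
    (fun x : E3 => (H ‖x - x₀‖ * quadY Q (x - x₀)) • (x - x₀))) x = 0
  rw [h0, curl_zero_field, curl_zero_field]

end Summit.NavierStokesRegularity.NavierStokesRegularity.Theorems.UnthreadedRigidity.ProfileHorn
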